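import Mathlib.Geometry.Manifold.SmoothEmbedding
import Mathlib.Geometry.Manifold.LocalDiffeomorph
import Mathlib.Geometry.Manifold.Diffeomorph
import Mathlib.Geometry.Manifold.ContMDiff.Defs
import Mathlib.Geometry.Manifold.ContMDiff.Constructions
import Mathlib.Geometry.Manifold.ContMDiff.NormedSpace
import Mathlib.Geometry.Manifold.IsManifold.InteriorBoundary
import HarnessLib

-- provenance: harness21/H21/H21/Prelude/FourManM/Isotopy.lean @ c47457c (interim HEAD d8f2665); M5 mechanical rewrite
/-!
# Smooth isotopies and ambient isotopies (trunk T-4MAN, outline C9)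

This prelude file of the H21 library (trunk `FourManM`, four-manifolds and knots) defines

* `Literature.SmoothIsotopy I J f g`: a smooth isotopy between two maps `f g : M → N` of `C^∞`
  manifolds, i.e. a jointly smooth family `F : ℝ → M → N` of smooth embeddings with `F 0 = f`
  and `F 1 = g`; `Literature.IsSmoothlyIsotopic I J f g` is the associated relation;
* `Literature.AmbientIsotopy J N`: an ambient isotopy of `N`, i.e. a jointly smooth family
  `F : ℝ → N → N` of diffeomorphisms with `F 0 = id`; the time-`t` diffeomorphism
  `Literature.Topology.FourManifolds.AmbientIsotopy.toDiffeomorph` is a *real* definition (via Mathlib's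
  `IsLocalDiffeomorph.diffeomorphOfBijective`); `Literature.IsAmbientIsotopic I J f g` says that
  `g = F 1 ∘ f` for some ambient isotopy `F`;
* `Literature.Diffeomorph.IsIsotopic φ ψ`: isotopy of self-diffeomorphisms of `N`, and the smooth
  mapping class *set* `Literature.Diffeomorph.IsotopyClass J N := Quot Diffeomorph.IsIsotopic`;
* the basic API: reflexivity/symmetry (real), transitivity and the equivalence statements
  (sorried: they need a reparametrisation flat at the endpoints), and the isotopy extension
  theorem `Literature.Topology.FourManifolds.isAmbientIsotopic_of_isSmoothlyIsotopic` (Hirsch 1976, Thm. 8.1.3; sorried).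

## Sources

* M. W. Hirsch, *Differential Topology*, Springer GTM 33 (1976), Ch. 8 (Isotopy), in particular
  §8.1, Theorem 8.1.3 (isotopy extension).
* R. S. Palais, *Local triviality of the restriction map for embeddings*, Comment. Math. Helv.
  34 (1960), 305–312.
* Mathlib: `Manifold.IsSmoothEmbedding` (`Mathlib.Geometry.Manifold.SmoothEmbedding`),
  `IsLocalDiffeomorph`, `IsLocalDiffeomorph.diffeomorphOfBijective`
  (`Mathlib.Geometry.Manifold.LocalDiffeomorph`), `Diffeomorph`. Mathlib has only the `C⁰`
  notion `ContinuousMap.Homotopy`; there is no smooth isotopy in Mathlib (searched `Isotop`).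

## Design choices

* **Time is parametrised by `ℝ`**, not by `unitInterval`: values of the family outside `[0, 1]`
  are irrelevant, and joint smoothness is simply
  `ContMDiff (𝓘(ℝ, ℝ).prod I) J ∞ (Function.uncurry F)`, avoiding manifolds with boundary.
  Any smooth isotopy on `[0, 1]` extends to `ℝ` after a reparametrisation flat near the
  endpoints, so the notion of "isotopic" is the classical one.
* All declarations live in namespace `Literature` (in particular `Literature.Topology.FourManifolds.SmoothIsotopy`, *not*
  `Manifold.SmoothIsotopy`, and `Literature.Topology.FourManifolds.Diffeomorph.IsIsotopic`, not in Mathlib's `Diffeomorph`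
  namespace), to be safe against future Mathlib additions.
* `AmbientIsotopy` records both `bijective` and `isLocalDiffeomorph` at each time: bijectivity
  of a smooth map alone would admit `x ↦ (1 - t) x + t x³` on `ℝ`, whose time-`1` map is not a
  diffeomorphism. With both fields, `AmbientIsotopy.toDiffeomorph` is a genuine definition.
* `Diffeomorph.IsIsotopic φ ψ` is isotopy **through embeddings** `N → N`. For closed connected
  `N` (the only case consumed downstream: mapping class sets of closed 4-manifolds) this agrees
  with diffeotopy (isotopy through diffeomorphisms), since an embedding of a closed connected
  manifold into itself is onto by invariance of domain.
* Generality: arbitrary real models with corners `I`, `J`; no `IsManifold` assumption in the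
  definitions (only where Mathlib's API needs it).
-/

open scoped Manifold ContDiff Topology
open Function

noncomputable section

namespace Literature.Topology.FourManifolds

variable {EM HM EN HN : Type*} [NormedAddCommGroup EM] [NormedSpace ℝ EM] [TopologicalSpace HM]
  [NormedAddCommGroup EN] [NormedSpace ℝ EN] [TopologicalSpace HN]
  (I : ModelWithCorners ℝ EM HM) (J : ModelWithCorners ℝ EN HN)
  {M : Type*} [TopologicalSpace M] [ChartedSpace HM M]
  (N : Type*) [TopologicalSpace N] [ChartedSpace HN N]

/-! ## Smooth isotopies of maps -/

variable {N} in
/-- A **smooth isotopy** from `f` to `g` (`f g : M → N` maps between `C^∞` manifolds modelled on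
`I` and `J`): a family `toFun : ℝ → M → N`, jointly `C^∞` in `(t, x)`, each `toFun t` a smooth
embedding, with `toFun 0 = f` and `toFun 1 = g`. Time runs over `ℝ`; only `[0, 1]` matters.
Hirsch, *Differential Topology* (1976), §8.1, p. 177 ("isotopy of embeddings"). [folklore] -/
structure SmoothIsotopy (f g : M → N) where
  /-- The family of maps `F t : M → N`, `t : ℝ`. -/
  toFun : ℝ → M → N
  /-- Joint smoothness of `(t, x) ↦ F t x`. -/
  contMDiff : ContMDiff (𝓘(ℝ, ℝ).prod I) J ∞ (uncurry toFun)
  /-- Each stage is a smooth embedding. -/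
  isSmoothEmbedding : ∀ t, Manifold.IsSmoothEmbedding I J ∞ (toFun t)
  /-- The isotopy starts at `f`. -/
  map_zero : toFun 0 = f
  /-- The isotopy ends at `g`. -/
  map_one : toFun 1 = g

variable {N} in
/-- `f` and `g` are **smoothly isotopic** if there is a smooth isotopy from `f` to `g`.
Hirsch, *Differential Topology* (1976), §8.1. [folklore] -/
def IsSmoothlyIsotopic (f g : M → N) : Prop :=
  Nonempty (SmoothIsotopy I J f g)

namespace SmoothIsotopy

variable {I J N} {f g : M → N}

/-- The constant isotopy at a smooth embedding `f`. Hirsch (1976), §8.1. [cite: Hirsch1976] -/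
def refl (hf : Manifold.IsSmoothEmbedding I J ∞ f) : SmoothIsotopy I J f f where
  toFun _ := f
  contMDiff := hf.contMDiff.comp contMDiff_snd
  isSmoothEmbedding _ := hf
  map_zero := rfl
  map_one := rfl

/-- The reversed isotopy `t ↦ F (1 - t)`. Hirsch (1976), §8.1. [cite: Hirsch1976] -/
def symm (F : SmoothIsotopy I J f g) : SmoothIsotopy I J g f where
  toFun t := F.toFun (1 - t)
  contMDiff := by
    have h : ContMDiff (𝓘(ℝ, ℝ).prod I) (𝓘(ℝ, ℝ).prod I) ∞
        (fun p : ℝ × M ↦ (1 - p.1, p.2)) :=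
      ((contDiff_const.sub contDiff_id).contMDiff.comp contMDiff_fst).prodMk contMDiff_snd
    exact F.contMDiff.comp h
  isSmoothEmbedding t := F.isSmoothEmbedding (1 - t)
  map_zero := by simpa using F.map_one
  map_one := by simpa using F.map_zero

/-- Stages of the constant isotopy. [folklore] -/
@[simp]
theorem refl_toFun (hf : Manifold.IsSmoothEmbedding I J ∞ f) (t : ℝ) :
    (refl hf).toFun t = f := rfl

/-- Stages of the reversed isotopy. [folklore] -/
@[simp]
theorem symm_toFun (F : SmoothIsotopy I J f g) (t : ℝ) :
    F.symm.toFun t = F.toFun (1 - t) := rfl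

end SmoothIsotopy

namespace IsSmoothlyIsotopic

variable {I J N} {f g h : M → N}

/-- Smooth isotopy is reflexive on smooth embeddings. Hirsch (1976), §8.1. [cite: Hirsch1976] -/
theorem refl (hf : Manifold.IsSmoothEmbedding I J ∞ f) : IsSmoothlyIsotopic I J f f :=
  ⟨.refl hf⟩

/-- Smooth isotopy is symmetric. Hirsch (1976), §8.1. [cite: Hirsch1976] -/
theorem symm (hfg : IsSmoothlyIsotopic I J f g) : IsSmoothlyIsotopic I J g f :=
  hfg.map SmoothIsotopy.symm

/-- Smooth isotopy is transitive: concatenate after reparametrising both isotopies to be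
constant near the endpoints (a smooth step function `ℝ → [0, 1]`), so that the concatenation is
jointly smooth. Hirsch (1976), §8.1, Exercise 1 / proof of Thm. 8.1.5. [cite: Hirsch1976] -/
def trans : Prop :=
  ∀ (hfg : IsSmoothlyIsotopic I J f g) (hgh : IsSmoothlyIsotopic I J g h),
    IsSmoothlyIsotopic I J f h

/-- Isotopic maps are smooth embeddings (stage `0` of an isotopy). [folklore] -/
theorem isSmoothEmbedding_left (hfg : IsSmoothlyIsotopic I J f g) :
    Manifold.IsSmoothEmbedding I J ∞ f := by
  obtain ⟨F⟩ := hfg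
  simpa only [F.map_zero] using F.isSmoothEmbedding 0

/-- Isotopic maps are smooth embeddings (stage `1` of an isotopy). [folklore] -/
theorem isSmoothEmbedding_right (hfg : IsSmoothlyIsotopic I J f g) :
    Manifold.IsSmoothEmbedding I J ∞ g := by
  obtain ⟨F⟩ := hfg
  simpa only [F.map_one] using F.isSmoothEmbedding 1

end IsSmoothlyIsotopic

/-- Smooth isotopy is an equivalence relation on the smooth embeddings `M → N`.
Hirsch (1976), §8.1. [cite: Hirsch1976] -/
def equivalence_isSmoothlyIsotopic : Prop :=
  Equivalence fun f g : {f : M → N // Manifold.IsSmoothEmbedding I J ∞ f} ↦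
      IsSmoothlyIsotopic I J f.1 g.1

/- interim proof relied on results that are now named facts (D-0014); demoted to a fact by the M5 import, proof preserved:
:=
  ⟨fun f ↦ .refl f.2, .symm, .trans⟩
-/

/-! ## Ambient isotopies -/

/-- An **ambient isotopy** of the manifold `N` (modelled on `J`): a family `toFun : ℝ → N → N`,
jointly `C^∞` in `(t, x)`, such that every stage `toFun t` is a bijective local diffeomorphism
(hence a diffeomorphism, see `AmbientIsotopy.toDiffeomorph`), starting at `toFun 0 = id`.
Both `bijective` and `isLocalDiffeomorph` are needed: bijectivity of a smooth stage alone would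
admit `x ↦ (1 - t) x + t x ^ 3` on `ℝ`, whose stage `1` is not a diffeomorphism.
Hirsch, *Differential Topology* (1976), §8.1, p. 178 ("ambient isotopy", "diffeotopy"). [folklore] -/
structure AmbientIsotopy where
  /-- The family of maps `F t : N → N`, `t : ℝ`. -/
  toFun : ℝ → N → N
  /-- Joint smoothness of `(t, x) ↦ F t x`. -/
  contMDiff : ContMDiff (𝓘(ℝ, ℝ).prod J) J ∞ (uncurry toFun)
  /-- Each stage is a bijection. -/
  bijective : ∀ t, Bijective (toFun t)
  /-- Each stage is a local diffeomorphism. -/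
  isLocalDiffeomorph : ∀ t, IsLocalDiffeomorph J J ∞ (toFun t)
  /-- The isotopy starts at the identity. -/
  map_zero : toFun 0 = id

namespace AmbientIsotopy

variable {J N}

/-- The stage-`t` diffeomorphism of an ambient isotopy: a bijective local diffeomorphism is a
diffeomorphism (Mathlib `IsLocalDiffeomorph.diffeomorphOfBijective`). Hirsch (1976), §8.1. [cite: Hirsch1976] -/
def toDiffeomorph (F : AmbientIsotopy J N) (t : ℝ) : N ≃ₘ^∞⟮J, J⟯ N :=
  (F.isLocalDiffeomorph t).diffeomorphOfBijective (F.bijective t)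

/-- The stage-`t` diffeomorphism is, as a function, the stage `F.toFun t` (definitionally). [folklore] -/
@[simp]
theorem coe_toDiffeomorph (F : AmbientIsotopy J N) (t : ℝ) :
    ⇑(F.toDiffeomorph t) = F.toFun t := rfl

/-- Each stage of an ambient isotopy is smooth. [folklore] -/
theorem contMDiff_toFun (F : AmbientIsotopy J N) (t : ℝ) : ContMDiff J J ∞ (F.toFun t) :=
  (F.isLocalDiffeomorph t).contMDiff

/-- The trivial ambient isotopy, constant equal to the identity. Hirsch (1976), §8.1. [cite: Hirsch1976] -/
protected def refl : AmbientIsotopy J N where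
  toFun _ := id
  contMDiff := contMDiff_snd
  bijective _ := bijective_id
  isLocalDiffeomorph _ := (Diffeomorph.refl J N ∞).isLocalDiffeomorph
  map_zero := rfl

/-- Stages of the trivial ambient isotopy. [folklore] -/
@[simp]
theorem refl_toFun (t : ℝ) :
    (AmbientIsotopy.refl : AmbientIsotopy J N).toFun t = id := rfl

end AmbientIsotopy

variable {N} in
/-- `f g : M → N` are **ambient isotopic** if `g = F 1 ∘ f` for some ambient isotopy `F` of `N`.
Hirsch, *Differential Topology* (1976), §8.1, p. 178. The model `I` of the source only serves to
fix the signature next to `IsSmoothlyIsotopic`. [folklore] -/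
@[nolint unusedArguments]
def IsAmbientIsotopic (_I : ModelWithCorners ℝ EM HM) (J : ModelWithCorners ℝ EN HN)
    {M : Type*} {N : Type*} [TopologicalSpace N] [ChartedSpace HN N] (f g : M → N) : Prop :=
  ∃ F : AmbientIsotopy J N, F.toFun 1 ∘ f = g

section Ambient

/- In this section the source `X` is a bare type: ambient isotopy of maps `X → N` does not use
any structure on the source. -/
variable {I J N} {X : Type*} {f g h : X → N}

/-- Ambient isotopy is reflexive (trivial ambient isotopy). Hirsch (1976), §8.1. [cite: Hirsch1976] -/
theorem isAmbientIsotopic_refl (f : X → N) : IsAmbientIsotopic I J f f :=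
  ⟨.refl, rfl⟩

/-- Ambient isotopy is symmetric: use `t ↦ F (1 - t) ∘ (F 1)⁻¹`, whose stages are
diffeomorphisms by
`AmbientIsotopy.toDiffeomorph`; joint smoothness of the inverse family follows from the
implicit function theorem. Hirsch (1976), §8.1. [cite: Hirsch1976] -/
def IsAmbientIsotopic.symm : Prop :=
  ∀ [IsManifold J ∞ N] (hfg : IsAmbientIsotopic I J f g),
    IsAmbientIsotopic I J g f

/-- Ambient isotopy is transitive: compose the (reparametrised) ambient isotopies stagewise.
Hirsch (1976), §8.1. [cite: Hirsch1976] -/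
def IsAmbientIsotopic.trans : Prop :=
  ∀ [IsManifold J ∞ N] (hfg : IsAmbientIsotopic I J f g) (hgh : IsAmbientIsotopic I J g h),
    IsAmbientIsotopic I J f h

variable (I J X N) in
/-- Ambient isotopy is an equivalence relation on all maps `X → N` (for a `C^∞` manifold `N`).
Hirsch (1976), §8.1. [cite: Hirsch1976] -/
def equivalence_isAmbientIsotopic : Prop :=
  ∀ [IsManifold J ∞ N],
    Equivalence (IsAmbientIsotopic I J : (X → N) → (X → N) → Prop)

/- interim proof relied on results that are now named facts (D-0014); demoted to a fact by the M5 import, proof preserved: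
:=
  ⟨isAmbientIsotopic_refl, .symm, .trans⟩
-/

end Ambient

section Extension

variable {I J N} {f g : M → N}

/-- Ambient isotopic smooth embeddings are smoothly isotopic: `t ↦ F t ∘ f` is a smooth isotopy
(composition of a diffeomorphism with a smooth embedding is a smooth embedding; this uses
`Manifold.IsSmoothEmbedding.comp`, currently only `proof_wanted` in Mathlib, whence `sorry`).
Hirsch (1976), §8.1. [cite: Hirsch1976] -/
def IsAmbientIsotopic.isSmoothlyIsotopic : Prop :=
  ∀ [IsManifold J ∞ N] (hf : Manifold.IsSmoothEmbedding I J ∞ f) (hfg : IsAmbientIsotopic I J f g),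
    IsSmoothlyIsotopic I J f g

/-- **Isotopy extension theorem** (Thom, Palais 1960, Cerf; Hirsch, *Differential Topology*
(1976), Ch. 8, Thm. 8.1.3/8.1.4): a smooth isotopy of embeddings of a compact manifold `M` into a
closed manifold `N` (compact, boundaryless, Hausdorff) is covered by an ambient isotopy of `N`;
in particular smoothly isotopic embeddings are ambient isotopic. [cite: Palais1960, Cerf] -/
def isAmbientIsotopic_of_isSmoothlyIsotopic : Prop :=
  ∀ [IsManifold I ∞ M] [CompactSpace M] [IsManifold J ∞ N] [CompactSpace N] [BoundarylessManifold J N] [T2Space N] (hfg : IsSmoothlyIsotopic I J f g),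
    IsAmbientIsotopic I J f g

/-- For embeddings of a compact manifold into a closed manifold, smooth isotopy and ambient
isotopy agree. Hirsch (1976), Thm. 8.1.3. [cite: Hirsch1976] -/
def isSmoothlyIsotopic_iff_isAmbientIsotopic : Prop :=
  ∀ [IsManifold I ∞ M] [CompactSpace M] [IsManifold J ∞ N] [CompactSpace N] [BoundarylessManifold J N] [T2Space N] (hf : Manifold.IsSmoothEmbedding I J ∞ f),
    IsSmoothlyIsotopic I J f g ↔ IsAmbientIsotopic I J f g

/- interim proof relied on results that are now named facts (D-0014); demoted to a fact by the M5 import, proof preserved: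
:=
  ⟨isAmbientIsotopic_of_isSmoothlyIsotopic, fun h ↦ h.isSmoothlyIsotopic hf⟩
-/

end Extension

/-! ## Isotopy of diffeomorphisms and the smooth mapping class set -/

variable {J N} in
/-- A diffeomorphism is a smooth embedding. This is Mathlib's
`proof_wanted Manifold.Diffeomorph.isSmoothEmbedding`
(`Mathlib.Geometry.Manifold.SmoothEmbedding`); the missing ingredient there is
`IsLocalDiffeomorph.isImmersion` (listed as TODO in `Mathlib.Geometry.Manifold.Immersion`).
Standard: Hirsch (1976), §1.3. [cite: Hirsch1976] -/
def isSmoothEmbedding_diffeomorph : Prop :=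
  ∀ [IsManifold J ∞ N] (φ : N ≃ₘ⟮J, J⟯ N),
    Manifold.IsSmoothEmbedding J J ∞ φ

namespace Diffeomorph

variable {J N}

/-- Two self-diffeomorphisms `φ ψ` of `N` are **isotopic** if they are smoothly isotopic as maps
`N → N`, i.e. through smooth *embeddings*. For closed connected `N` (the only case consumed in
H21) this is the same as diffeotopy (isotopy through diffeomorphisms): a self-embedding of a
closed connected manifold is onto by invariance of domain. Hirsch (1976), §8.1, p. 178.
This is `Literature.Topology.FourManifolds.Diffeomorph.IsIsotopic` (not placed in Mathlib's `Diffeomorph` namespace). [cite: Hirsch1976] -/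
def IsIsotopic (φ ψ : N ≃ₘ⟮J, J⟯ N) : Prop :=
  IsSmoothlyIsotopic J J ⇑φ ⇑ψ

variable (J N) in
/-- The **smooth mapping class set** of `N`: self-diffeomorphisms of `N` modulo isotopy,
`Quot Diffeomorph.IsIsotopic`. (It is a group under composition; the group structure is not
needed in H21 v0.) Hirsch (1976), §8.1; cf. `π₀ Diff(N)`. [cite: Hirsch1976] -/
def IsotopyClass : Type _ :=
  Quot (Diffeomorph.IsIsotopic (J := J) (N := N))

/-- The isotopy class of a diffeomorphism. [folklore] -/
def IsotopyClass.mk (φ : N ≃ₘ⟮J, J⟯ N) : IsotopyClass J N :=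
  Quot.mk _ φ

/-- Isotopy of diffeomorphisms is reflexive (a diffeomorphism is a smooth embedding).
Hirsch (1976), §8.1. [cite: Hirsch1976] -/
def IsIsotopic.refl : Prop :=
  ∀ [IsManifold J ∞ N] (φ : N ≃ₘ⟮J, J⟯ N),
    IsIsotopic φ φ

/- interim proof relied on results that are now named facts (D-0014); demoted to a fact by the M5 import, proof preserved:
:=
  IsSmoothlyIsotopic.refl (isSmoothEmbedding_diffeomorph φ)
-/

/-- Isotopy of diffeomorphisms is symmetric. Hirsch (1976), §8.1. [cite: Hirsch1976] -/
theorem IsIsotopic.symm {φ ψ : N ≃ₘ⟮J, J⟯ N} (h : IsIsotopic φ ψ) : IsIsotopic ψ φ :=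
  IsSmoothlyIsotopic.symm h

/-- Isotopy of diffeomorphisms is transitive. Hirsch (1976), §8.1. [cite: Hirsch1976] -/
def IsIsotopic.trans : Prop :=
  ∀ {φ ψ χ : N ≃ₘ⟮J, J⟯ N} (h₁ : IsIsotopic φ ψ) (h₂ : IsIsotopic ψ χ),
    IsIsotopic φ χ

/- interim proof relied on results that are now named facts (D-0014); demoted to a fact by the M5 import, proof preserved:
:=
  IsSmoothlyIsotopic.trans h₁ h₂
-/

/-- Two diffeomorphisms have the same isotopy class iff they are isotopic (isotopy is already an
equivalence relation on diffeomorphisms of a `C^∞` manifold). [folklore] -/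
def IsotopyClass.mk_eq_mk_iff : Prop :=
  ∀ [IsManifold J ∞ N] {φ ψ : N ≃ₘ⟮J, J⟯ N},
    IsotopyClass.mk φ = IsotopyClass.mk ψ ↔ IsIsotopic φ ψ

/- interim proof relied on results that are now named facts (D-0014); demoted to a fact by the M5 import, proof preserved:
:= by
  have hE : Equivalence (IsIsotopic (J := J) (N := N)) := ⟨.refl, .symm, .trans⟩
  refine ⟨fun hmk ↦ ?_, fun hiso ↦ Quot.sound hiso⟩
  exact (hE.eqvGen_iff).mp (Quot.eqvGen_exact hmk)
-/

/-- Every isotopy class is the class of a diffeomorphism. [folklore] -/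
theorem IsotopyClass.mk_surjective :
    Surjective (IsotopyClass.mk : (N ≃ₘ⟮J, J⟯ N) → IsotopyClass J N) :=
  Quot.mk_surjective

/-- For a closed manifold `N`, two diffeomorphisms are isotopic iff they are ambient isotopic as
maps, i.e. iff `ψ = F 1 ∘ φ` for an ambient isotopy `F` (isotopy extension, Hirsch (1976),
Thm. 8.1.3, plus `Diffeomorph.isSmoothEmbedding`). [cite: Hirsch1976] -/
def isIsotopic_iff_isAmbientIsotopic : Prop :=
  ∀ [IsManifold J ∞ N] [CompactSpace N] [BoundarylessManifold J N] [T2Space N] {φ ψ : N ≃ₘ⟮J, J⟯ N},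
    IsIsotopic φ ψ ↔ IsAmbientIsotopic J J ⇑φ ⇑ψ

/- interim proof relied on results that are now named facts (D-0014); demoted to a fact by the M5 import, proof preserved:
:=
  isSmoothlyIsotopic_iff_isAmbientIsotopic (isSmoothEmbedding_diffeomorph φ)
-/

end Diffeomorph

end Literature.Topology.FourManifolds

/-! ## Discharge: symmetry of ambient isotopy -/

namespace Literature.Topology.FourManifolds

section SymmHolds

variable {EM HM EN HN : Type*} [NormedAddCommGroup EM] [NormedSpace ℝ EM] [TopologicalSpace HM]
  [NormedAddCommGroup EN] [NormedSpace ℝ EN] [TopologicalSpace HN]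
  {I : ModelWithCorners ℝ EM HM} {J : ModelWithCorners ℝ EN HN}
  {N : Type*} [TopologicalSpace N] [ChartedSpace HN N] {X : Type*} {f g : X → N}

namespace AmbientIsotopy

/-- The **reversed ambient isotopy** `t ↦ F (1 - t) ∘ (F 1)⁻¹` of an ambient isotopy `F`: it
starts at `id` and ends at `(F 1)⁻¹`. Each stage is the diffeomorphism
`(F.toDiffeomorph 1).symm.trans (F.toDiffeomorph (1 - t))`; joint smoothness is that of
`uncurry F` composed with the smooth map `(t, x) ↦ (1 - t, (F 1)⁻¹ x)`.
Hirsch, *Differential Topology* (1976), §8.1, p. 178. [cite: Hirsch1976] -/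
def reverse (F : AmbientIsotopy J N) : AmbientIsotopy J N where
  toFun t := ⇑((F.toDiffeomorph 1).symm.trans (F.toDiffeomorph (1 - t)))
  contMDiff := by
    have h : ContMDiff (𝓘(ℝ, ℝ).prod J) (𝓘(ℝ, ℝ).prod J) ∞
        (fun p : ℝ × N ↦ (1 - p.1, (F.toDiffeomorph 1).symm p.2)) :=
      ((contDiff_const.sub contDiff_id).contMDiff.comp contMDiff_fst).prodMk
        ((F.toDiffeomorph 1).symm.contMDiff.comp contMDiff_snd)
    exact F.contMDiff.comp h
  bijective t := ((F.toDiffeomorph 1).symm.trans (F.toDiffeomorph (1 - t))).bijective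
  isLocalDiffeomorph t :=
    ((F.toDiffeomorph 1).symm.trans (F.toDiffeomorph (1 - t))).isLocalDiffeomorph
  map_zero := by
    funext x
    rw [sub_zero, Diffeomorph.coe_trans, Function.comp_apply, Diffeomorph.apply_symm_apply, id]

/-- Stages of the reversed ambient isotopy. [folklore] -/
@[simp]
theorem reverse_toFun (F : AmbientIsotopy J N) (t : ℝ) :
    F.reverse.toFun t = F.toFun (1 - t) ∘ ⇑(F.toDiffeomorph 1).symm := rfl

/-- The reversed ambient isotopy ends at `(F 1)⁻¹`. [folklore] -/
theorem reverse_toFun_one (F : AmbientIsotopy J N) :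
    F.reverse.toFun 1 = ⇑(F.toDiffeomorph 1).symm := by
  rw [reverse_toFun, sub_self, F.map_zero, Function.id_comp]

end AmbientIsotopy

/-- **Discharge** of `IsAmbientIsotopic.symm`: ambient isotopy is symmetric. If `g = F 1 ∘ f`,
then `f = F.reverse 1 ∘ g` with `F.reverse t = F (1 - t) ∘ (F 1)⁻¹` (`AmbientIsotopy.reverse`);
no inverse *family* (and no implicit function theorem) is needed, only the fixed inverse
`(F 1)⁻¹ = (F.toDiffeomorph 1).symm`. The `IsManifold` hypothesis of the fact is not used.
Hirsch, *Differential Topology* (1976), §8.1, p. 178 (isotopy and ambient isotopy are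
equivalence relations). [cite: Hirsch1976] -/
theorem IsAmbientIsotopic.symm_holds : IsAmbientIsotopic.symm (I := I) (J := J) (f := f) (g := g) := by
  intro _ hfg
  obtain ⟨F, rfl⟩ := hfg
  refine ⟨F.reverse, ?_⟩
  funext x
  rw [F.reverse_toFun_one, Function.comp_apply, Function.comp_apply, ← F.coe_toDiffeomorph,
    Diffeomorph.symm_apply_apply]

end SymmHolds

end Literature.Topology.FourManifolds

/-! ## Discharge: a diffeomorphism is a smooth embedding; reflexivity of isotopy of diffeomorphisms -/

namespace Literature.Topology.FourManifolds

section ReflHolds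

open Set

variable {EN HN : Type*} [NormedAddCommGroup EN] [NormedSpace ℝ EN] [TopologicalSpace HN]
  {J : ModelWithCorners ℝ EN HN}
  {N : Type*} [TopologicalSpace N] [ChartedSpace HN N]

/-- The chart of `N` around `φ x` obtained by **transporting** the preferred chart at `x` along a
diffeomorphism `φ : N ≃ₘ N`: as a map it is `chartAt x ∘ φ⁻¹`, with source `φ⁻¹ ⁻¹' (chartAt x).source`
and inverse `φ ∘ (chartAt x).symm` (all definitional, via `Homeomorph.transOpenPartialHomeomorph`).
In this chart and `chartAt x`, the map `φ` reads as the identity. [folklore] -/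
def Diffeomorph.transportedChart (φ : N ≃ₘ⟮J, J⟯ N) (x : N) : OpenPartialHomeomorph N HN :=
  φ.symm.toHomeomorph.transOpenPartialHomeomorph (chartAt HN x)

/-- `φ x` lies in the source of the transported chart. [folklore] -/
theorem Diffeomorph.mem_transportedChart_source (φ : N ≃ₘ⟮J, J⟯ N) (x : N) :
    φ x ∈ (Diffeomorph.transportedChart φ x).source := by
  simp [Diffeomorph.transportedChart]

/-- The transported chart `chartAt x ∘ φ⁻¹` belongs to the maximal `C^∞` atlas of `N`: both it and
its inverse `φ ∘ (chartAt x).symm` are `C^∞` on their domains (Mathlib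
`OpenPartialHomeomorph.mem_maximalAtlas_of_contMDiffOn`). [folklore] -/
theorem Diffeomorph.transportedChart_mem_maximalAtlas [IsManifold J ∞ N] (φ : N ≃ₘ⟮J, J⟯ N)
    (x : N) : Diffeomorph.transportedChart φ x ∈ IsManifold.maximalAtlas J ∞ N := by
  apply OpenPartialHomeomorph.mem_maximalAtlas_of_contMDiffOn
  · simp only [Diffeomorph.transportedChart, Homeomorph.transOpenPartialHomeomorph_source,
      Homeomorph.transOpenPartialHomeomorph_apply, Diffeomorph.coe_toHomeomorph]
    exact contMDiffOn_chart.comp φ.symm.contMDiff.contMDiffOn (fun _ h ↦ h)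
  · simp only [Diffeomorph.transportedChart, Homeomorph.transOpenPartialHomeomorph_target,
      Homeomorph.transOpenPartialHomeomorph_symm_apply, Diffeomorph.symm_toHomeomorph,
      Homeomorph.symm_symm, Diffeomorph.coe_toHomeomorph]
    exact φ.contMDiff.comp_contMDiffOn contMDiffOn_chart_symm

/-- **Discharge** of `isSmoothEmbedding_diffeomorph` (Mathlib's
`proof_wanted Manifold.Diffeomorph.isSmoothEmbedding`): a diffeomorphism `φ` of a `C^∞` manifold
`N` is a smooth embedding in Mathlib's sense (`Manifold.IsSmoothEmbedding` = immersion + topological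
embedding). *Immersion* (with complement `Unit`): at `x`, in the charts `chartAt x` on the source
and the transported chart `chartAt x ∘ φ⁻¹` (`Diffeomorph.transportedChart`, in the maximal atlas by
`Diffeomorph.transportedChart_mem_maximalAtlas`) on the target, `φ` reads as the identity of
`(chartAt x).extend J).target`, i.e. as `ContinuousLinearEquiv.prodUnique ∘ (·, 0)`; this is the
argument of Mathlib's `Manifold.IsImmersionOfComplement.id` with the target chart transported.
*Embedding*: `φ.toHomeomorph.isEmbedding`.
Source: Hirsch, *Differential Topology*, GTM 33 (1976), Ch. 1 §3 (definition of embedding: "an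
immersion which maps `M` homeomorphically onto its image", just before Thm. 1.3.1); a
diffeomorphism has bijective tangent maps (Ch. 1 §2), hence is an immersion, and is a
homeomorphism onto `N`. [cite: Hirsch1976, Ch. 1 §3, before Thm. 1.3.1] -/
theorem isSmoothEmbedding_diffeomorph_holds :
    isSmoothEmbedding_diffeomorph (J := J) (N := N) := by
  intro _ φ
  refine ⟨?_, by simpa using φ.toHomeomorph.isEmbedding⟩
  refine Manifold.IsImmersionOfComplement.isImmersion (F := Unit) fun x ↦ ?_
  apply Manifold.IsImmersionAtOfComplement.mk_of_continuousAt φ.continuous.continuousAt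
    (.prodUnique ℝ EN _) (chartAt HN x) (Diffeomorph.transportedChart φ x) (mem_chart_source HN x)
    (Diffeomorph.mem_transportedChart_source φ x)
    (IsManifold.chart_mem_maximalAtlas x) (Diffeomorph.transportedChart_mem_maximalAtlas φ x)
  intro y hy
  have : J ((chartAt HN x) ((chartAt HN x).symm (J.symm y))) = y := by
    rw [(chartAt HN x).right_inv (by simp_all), J.right_inv (by simp_all)]
  simpa [Diffeomorph.transportedChart]

/-- **Discharge** of `Diffeomorph.IsIsotopic.refl`: isotopy of self-diffeomorphisms of a `C^∞`
manifold is reflexive — the constant family `t ↦ φ` is a smooth isotopy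
(`IsSmoothlyIsotopic.refl`) because a diffeomorphism is a smooth embedding
(`isSmoothEmbedding_diffeomorph_holds`). Source: Hirsch, *Differential Topology*, GTM 33 (1976),
Ch. 8 §1, before Thm. 8.1.1 (definition of isotopy and diffeotopy; that "isotopic" is an
equivalence relation is noted in Ch. 4 §5, before Thm. 4.5.3), together with Ch. 1 §3
(embeddings). [cite: Hirsch1976, Ch. 8 §1, before Thm. 8.1.1] -/
theorem Diffeomorph.IsIsotopic.refl_holds : Diffeomorph.IsIsotopic.refl (J := J) (N := N) :=
  fun φ ↦ IsSmoothlyIsotopic.refl (isSmoothEmbedding_diffeomorph_holds φ)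

end ReflHolds

end Literature.Topology.FourManifolds
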